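/-
Copyright (c) 2026. All rights reserved.
Released under Apache 2.0 license as described in the file LICENSE.
Authors: abc-iut cell — seat abc-iut-f-098 (F fact-proving wave, tranche 98: FACT-LIST rows F-0109, F-0110, F-0111).
-/
import Literature.AnabelianGeometry.AbsoluteAnabelian.GaloisTheatersTrivialContext
import HarnessLib

/-!
# [AbsTopIII] Rmk 5.1.1 / Cor 5.2 (i): the named facts on global Galois-theaters, discharged conditionally along print's argument

S. Mochizuki, *Topics in absolute anabelian geometry III: global reconstruction algorithms*
[MochizukiAbsTopIII2015], Rmk 5.1.1 p. 118 and Cor 5.2 (i) p. 119 (pages of the author's manuscript, lit key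
`paper:url-5493eb38cbb7`).

`GaloisTheaters.lean` types Rmk 5.1.1 and Cor 5.2 (i) as NAMED `Prop` FACTS over an abstract interface context
`R : GlobalAnabelianContext` (FACT-LIST rows F-0109 `ReferenceIsoUnique`, F-0110 `TheaterHomDeterminedByGroupHom`,
F-0111 `TheaterIsoCanonical`), each docstring saying "an ASSUMPTION on `R`: it holds for the context of Thm 1.9 /
Cor 2.8, not for an arbitrary `R`".  Their universal closures over the bare interface are FALSE (kernel witnesses in
the companion file `GaloisTheatersRmk511Schema.lean`).  This PROOF-ONLY file (no `def` / `instance` / `structure` /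
notation) DISCHARGES them CONDITIONALLY, typing print's own proof of Rmk 5.1.1 ("for nonarchimedean elements, this
follows from the well-known fact that a nonarchimedean prime is uniquely determined by any open subgroup of its
decomposition group [NSW, Cor 12.1.3]; for archimedean elements, by considering the topology induced on `k_NF(Π_X)`
by `A_{X_v}` via `κ_v`"):

* `IsReferenceIsoFor.decomp_apply`, `IsReferenceIsoFor.induced_eq` — a reference isomorphism preserves
  decomposition groups and the `κ`-induced topologies on `k_NF(Π)`;
* `referenceIsoUnique_of_separated` — F-0109 (`ψ_V` unique) ⇐ (non) decomposition groups separate `V(Π)^non` ∧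
  (arc) the `κ_{ell,v}`-induced topologies on `k_NF(Π)` separate `V(Π)^arc`;
* `theaterHomDeterminedByGroupHom_of_separated` — F-0110 (`φ_V` determined by `φ_Π`) ⇐ the open-subgroup form of
  (non) (the [NSW, Cor 12.1.3] shape: `U ∩ Π_v ⊆ Π_w` for an open subgroup `U ⊆ Π` forces `v = w`) ∧ (arc);
* `theaterIsoCanonical_of_mapKNF_id` — F-0111 (Cor 5.2 (i), essential surjectivity of `An⊚[Th⊚] → Th⊚`) ⇐
  `k_NF(𝟙_Π) = id`, i.e. functoriality of `k_NF(−)` at identities, which the interface record does not assert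
  (observation I-L4-t3-1 of `GaloisTheatersTrivialContext.lean`) while print's "functorially construct" does.

HONEST LABEL: the three rows stay ASSUMPTIONS at the intended model (the genuine context = étale `π₁` + [AbsTopIII]
Thm 1.9 / Cor 2.8–2.9 is not in the tree, FOUNDATIONS row 12); what is kernel-checked here is that they follow from
the two primitive separation properties and the one functoriality law print's proof invokes.  Nothing of [AbsTopIII]
is asserted; nothing here bears on the disputed [IUTchIII] Cor. 3.12; a FACT row is an assumption label, not an
endorsement.
-/

namespace Literature.AnabelianGeometry.AbsoluteAnabelian

open CategoryTheory Topology TopologicalSpace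

universe u

/-! ### Reference isomorphisms: stabilisers and induced topologies -/

section ReferenceIso

variable {R : GlobalAnabelianContext.{u}} {E : FundamentalExtension.{u}} {V : GaloisProSet E.arith}
  {X : V.arc → AutHolOrbispace.{u}} {δ : (v : V.arc) → E.geom ≃ₜ* (X v).pi1Hat}
  {κ : (v : V.arc) → R.kNF E →+* (X v).fieldA} {ψ : (R.proVal E).carrier ≃ₜ V.carrier}

/-- Along a reference isomorphism `ψ` (condition (a): `Π`-equivariance), the decomposition group of `ψ(v)` IS the
decomposition group of `v`. [cite: MochizukiAbsTopIII2015, Def 5.1 (iii) p. 115] -/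
theorem IsReferenceIsoFor.decomp_apply (h : IsReferenceIsoFor R E V X δ κ ψ) (v : (R.proVal E).carrier) :
    V.decomp (ψ v) = (R.proVal E).decomp v := by
  ext g
  simp only [GaloisProSet.decomp, MulAction.mem_stabilizer_iff]
  rw [← h.1, ψ.injective.eq_iff]

/-- Along a reference isomorphism `ψ` (condition (b): `κ_v = ψ_v ∘ κ_{ell,v_ell}` with `ψ_v` bicontinuous on `A`),
"the topology induced on `k_NF(Π)` by `A_{X_v}` via `κ_v`" (Rmk 5.1.1) at `v = ψ(v_ell)` equals the topology
induced by `A_{X(Π,v_ell)}` via `κ_{ell,v_ell}`. [cite: MochizukiAbsTopIII2015, Rmk 5.1.1 p. 118] -/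
theorem IsReferenceIsoFor.induced_eq (h : IsReferenceIsoFor R E V X δ κ ψ) (v : (R.proVal E).arc) (w : V.arc)
    (hw : (w : V.carrier) = ψ v) :
    induced (κ w) (X w).topA = induced (R.κell E v) (R.archSpace E v).topA := by
  obtain ⟨w, hw'⟩ := w
  change w = ψ v at hw
  subst hw
  obtain ⟨ψv, hhomeo, -, hκ⟩ := h.2.2.2.2 v hw'
  have hfun : (κ ⟨ψ v, hw'⟩ : R.kNF E → (X ⟨ψ v, hw'⟩).fieldA) = ψv.fieldIso ∘ R.κell E v := funext hκ
  have hind : induced ψv.fieldIso (X ⟨ψ v, hw'⟩).topA = (R.archSpace E v).topA := hhomeo.homeomorph.induced_eq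
  rw [hfun, ← induced_compose, hind]

end ReferenceIso

/-! ### Conditional discharges of Rmk 5.1.1 and Cor 5.2 (i) -/

section Conditional

variable (R : GlobalAnabelianContext.{u})

/-- **Rmk 5.1.1 (uniqueness of `ψ_V`), discharged from the two separation properties print's proof invokes**:
if, on `Ob(EA⊚)`, (non) distinct nonarchimedean elements of `V(Π)` have distinct decomposition groups ("a
nonarchimedean prime is uniquely determined by [...] its decomposition group [NSW, Cor 12.1.3]") and (arc) distinct
archimedean elements induce, via `κ_{ell,v} : k_NF(Π) ↪ A_{X(Π,v)}`, distinct topologies on `k_NF(Π)` ("by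
considering the topology induced on `k_NF(Π_X)` by `A_{X_v}` via `κ_v`"), then the reference isomorphism of every
global Galois-theater is unique.  Proof as printed: `ψ₂⁻¹ ∘ ψ₁` is `Π`-equivariant, so preserves decomposition
groups, and transports `κ`-induced topologies. [cite: MochizukiAbsTopIII2015, Rmk 5.1.1 p. 118] -/
theorem referenceIsoUnique_of_separated
    (hnon : ∀ E, R.IsAdmissible E → ∀ v w : (R.proVal E).carrier, v ∈ (R.proVal E).non →
      w ∈ (R.proVal E).non → (R.proVal E).decomp v = (R.proVal E).decomp w → v = w)
    (harc : ∀ E, R.IsAdmissible E → ∀ v w : (R.proVal E).arc,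
      induced (R.κell E v) (R.archSpace E v).topA = induced (R.κell E w) (R.archSpace E w).topA → v = w) :
    ReferenceIsoUnique R := by
  intro T ψ₁ ψ₂ h₁ h₂
  ext v
  rcases (R.proVal T.ext).eq_generic_or_mem v with hv | hv | hv
  · rw [hv, h₁.2.1, h₂.2.1]
  · have hv' : ψ₁ v ∈ ψ₂ '' (R.proVal T.ext).non := by
      rw [h₂.2.2.1, ← h₁.2.2.1]
      exact ⟨v, hv, rfl⟩
    obtain ⟨u, hu, hueq⟩ := hv'
    have huv : u = v :=
      hnon T.ext T.isAdmissible u v hu hv (by rw [← h₂.decomp_apply u, hueq, h₁.decomp_apply v])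
    rw [← hueq, huv]
  · have hv₁ : ψ₁ v ∈ T.V.arc := by
      rw [← h₁.2.2.2.1]
      exact ⟨v, hv, rfl⟩
    have hv' : ψ₁ v ∈ ψ₂ '' (R.proVal T.ext).arc := by
      rw [h₂.2.2.2.1, ← h₁.2.2.2.1]
      exact ⟨v, hv, rfl⟩
    obtain ⟨u, hu, hueq⟩ := hv'
    have e₁ := h₁.induced_eq ⟨v, hv⟩ ⟨ψ₁ v, hv₁⟩ rfl
    have e₂ := h₂.induced_eq ⟨u, hu⟩ ⟨ψ₁ v, hv₁⟩ hueq.symm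
    have huv : (⟨u, hu⟩ : (R.proVal T.ext).arc) = ⟨v, hv⟩ :=
      harc T.ext T.isAdmissible _ _ (e₂.symm.trans e₁)
    rw [← hueq, show u = v from congrArg Subtype.val huv]

/-- **Rmk 5.1.1, last sentence (`φ_V` is determined by `φ_Π`), discharged from the separation properties print's
proof invokes**: (non) "a nonarchimedean prime is uniquely determined by any open subgroup of its decomposition
group [NSW, Cor 12.1.3]" — typed: if an open subgroup `U ⊆ Π` satisfies `U ∩ Π_v ⊆ Π_w` then `v = w`; (arc) distinct
archimedean elements of `V(Π)` induce distinct topologies on `k_NF(Π)` via `κ_{ell,v}`.  Proof as printed: for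
`φ, φ' : V⊚₁ → V⊚₂` over the same open injection `φ_Π`, `φ_Π(Π₁) ∩ Π_{2,φ_V(v)} = φ_Π(Π_{1,v}) =
φ_Π(Π₁) ∩ Π_{2,φ'_V(v)}`, and `κ_{φ_V(v)} ∘ k_NF(φ_Π)`, `κ_{φ'_V(v)} ∘ k_NF(φ_Π)` induce the topology of `κ_v`;
conclude through a reference isomorphism of `V⊚₂`. [cite: MochizukiAbsTopIII2015, Rmk 5.1.1 p. 118] -/
theorem theaterHomDeterminedByGroupHom_of_separated
    (hnon : ∀ E, R.IsAdmissible E → ∀ v w : (R.proVal E).carrier, v ∈ (R.proVal E).non →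
      w ∈ (R.proVal E).non → ∀ U : Subgroup E.arith, IsOpen (U : Set E.arith) →
      U ⊓ (R.proVal E).decomp v ≤ (R.proVal E).decomp w → v = w)
    (harc : ∀ E, R.IsAdmissible E → ∀ v w : (R.proVal E).arc,
      induced (R.κell E v) (R.archSpace E v).topA = induced (R.κell E w) (R.archSpace E w).topA → v = w) :
    TheaterHomDeterminedByGroupHom R := by
  intro T₁ T₂ φ φ' hφ
  obtain ⟨ψ, hψ⟩ := T₂.exists_referenceIso
  have harith : ∀ g, φ'.φgrp.arith g = φ.φgrp.arith g := fun g => by rw [hφ]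
  have hmap : ∀ x, R.mapKNF φ'.φgrp φ'.isEAHom x = R.mapKNF φ.φgrp φ.isEAHom x := by
    intro x
    obtain ⟨f', hf', φV', h1, h2, h3, h4, h5⟩ := φ'
    cases hφ
    rfl
  ext v
  rcases T₁.V.eq_generic_or_mem v with hv | hv | hv
  · rw [hv, φ.φV_generic, φ'.φV_generic]
  · -- nonarchimedean elements: compare decomposition groups inside the open subgroup `φ_Π(Π₁)`
    have hw : φ.φV v ∈ ψ '' (R.proVal T₂.ext).non := by
      rw [hψ.2.2.1, ← φ.image_non]
      exact ⟨v, hv, rfl⟩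
    have hw' : φ'.φV v ∈ ψ '' (R.proVal T₂.ext).non := by
      rw [hψ.2.2.1, ← φ'.image_non]
      exact ⟨v, hv, rfl⟩
    obtain ⟨u, hu, hueq⟩ := hw
    obtain ⟨u', hu', hueq'⟩ := hw'
    have key : ∀ g : T₁.ext.arith, φ.φgrp.arith g ∈ (R.proVal T₂.ext).decomp u ↔ g • v = v := fun g => by
      rw [← hψ.decomp_apply u, hueq]
      simp only [GaloisProSet.decomp, MulAction.mem_stabilizer_iff]
      rw [← φ.φV_smul, φ.φV.injective.eq_iff]
    have key' : ∀ g : T₁.ext.arith, φ.φgrp.arith g ∈ (R.proVal T₂.ext).decomp u' ↔ g • v = v := fun g => by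
      rw [← hψ.decomp_apply u', hueq', ← harith]
      simp only [GaloisProSet.decomp, MulAction.mem_stabilizer_iff]
      rw [← φ'.φV_smul, φ'.φV.injective.eq_iff]
    have huu : u = u' :=
      hnon T₂.ext T₂.isAdmissible u u' hu hu' φ.φgrp.arith.toMonoidHom.range φ.isEAHom.isOpen_range (by
        rintro _ ⟨⟨g, rfl⟩, hg⟩
        exact (key' g).mpr ((key g).mp hg))
    rw [← hueq, ← hueq', huu]
  · -- archimedean elements: compare the topologies induced on `k_NF(Π₂)`
    have hw : φ.φV v ∈ T₂.V.arc := by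
      rw [← φ.image_arc]
      exact ⟨v, hv, rfl⟩
    have hw' : φ'.φV v ∈ T₂.V.arc := by
      rw [← φ'.image_arc]
      exact ⟨v, hv, rfl⟩
    obtain ⟨φv, hh, -, hκ⟩ := φ.arch_compat ⟨v, hv⟩ hw
    obtain ⟨φv', hh', -, hκ'⟩ := φ'.arch_compat ⟨v, hv⟩ hw'
    set m := R.mapKNF φ.φgrp φ.isEAHom with hm
    have e : induced m (induced (T₂.κ ⟨φ.φV v, hw⟩) (T₂.X ⟨φ.φV v, hw⟩).topA) =
        induced (T₁.κ ⟨v, hv⟩) (T₁.X ⟨v, hv⟩).topA := by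
      have hfun : (T₂.κ ⟨φ.φV v, hw⟩ : R.kNF T₂.ext → _) ∘ m = φv.fieldIso ∘ T₁.κ ⟨v, hv⟩ :=
        funext fun x => hκ x
      have hind : induced φv.fieldIso (T₂.X ⟨φ.φV v, hw⟩).topA = (T₁.X ⟨v, hv⟩).topA :=
        hh.homeomorph.induced_eq
      rw [induced_compose, hfun, ← induced_compose, hind]
    have e' : induced m (induced (T₂.κ ⟨φ'.φV v, hw'⟩) (T₂.X ⟨φ'.φV v, hw'⟩).topA) =
        induced (T₁.κ ⟨v, hv⟩) (T₁.X ⟨v, hv⟩).topA := by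
      have hfun : (T₂.κ ⟨φ'.φV v, hw'⟩ : R.kNF T₂.ext → _) ∘ m = φv'.fieldIso ∘ T₁.κ ⟨v, hv⟩ :=
        funext fun x => by
          show T₂.κ _ (m x) = φv'.fieldIso (T₁.κ ⟨v, hv⟩ x)
          rw [← hmap x]
          exact hκ' x
      have hind : induced φv'.fieldIso (T₂.X ⟨φ'.φV v, hw'⟩).topA = (T₁.X ⟨v, hv⟩).topA :=
        hh'.homeomorph.induced_eq
      rw [induced_compose, hfun, ← induced_compose, hind]
    -- cancel the bijection `m = k_NF(φ_Π)`
    have hcancel : ∀ t : TopologicalSpace (R.kNF T₂.ext), induced m.symm (induced m t) = t := fun t => by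
      rw [induced_compose, show (m : R.kNF T₁.ext → R.kNF T₂.ext) ∘ m.symm = id from
        funext fun x => m.apply_symm_apply x, induced_id]
    have e₂ : induced (T₂.κ ⟨φ.φV v, hw⟩) (T₂.X ⟨φ.φV v, hw⟩).topA =
        induced (T₂.κ ⟨φ'.φV v, hw'⟩) (T₂.X ⟨φ'.φV v, hw'⟩).topA := by
      rw [← hcancel (induced (T₂.κ ⟨φ.φV v, hw⟩) _), e, ← e', hcancel]
    -- pull back along the reference isomorphism of `V⊚₂`
    have hwψ : φ.φV v ∈ ψ '' (R.proVal T₂.ext).arc := by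
      rw [hψ.2.2.2.1]
      exact hw
    have hwψ' : φ'.φV v ∈ ψ '' (R.proVal T₂.ext).arc := by
      rw [hψ.2.2.2.1]
      exact hw'
    obtain ⟨u, hu, hueq⟩ := hwψ
    obtain ⟨u', hu', hueq'⟩ := hwψ'
    have f₁ := hψ.induced_eq ⟨u, hu⟩ ⟨φ.φV v, hw⟩ hueq.symm
    have f₂ := hψ.induced_eq ⟨u', hu'⟩ ⟨φ'.φV v, hw'⟩ hueq'.symm
    have huu : (⟨u, hu⟩ : (R.proVal T₂.ext).arc) = ⟨u', hu'⟩ :=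
      harc T₂.ext T₂.isAdmissible _ _ (f₁.symm.trans (e₂.trans f₂))
    rw [← hueq, ← hueq', show u = u' from congrArg Subtype.val huu]

/-- **Cor 5.2 (i), essential surjectivity of `An⊚[Th⊚] → Th⊚`, discharged from functoriality of `k_NF(−)` at
identities**: if `k_NF(𝟙_Π) = id` for every `Π`, then the reference isomorphism `ψ_V` of any global Galois-theater
`V⊚` IS a morphism of theaters `V⊚(Π) → V⊚` lying over `𝟙_Π` (conditions (a), (b) of a morphism over `𝟙_Π` are
literally conditions (a), (b) on `ψ_V`, once `k_NF(𝟙_Π)` is the identity).  The interface record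
`GlobalAnabelianContext` does not assert this law (observation I-L4-t3-1); print's "functorially construct" does.
[cite: MochizukiAbsTopIII2015, Cor 5.2 (i) p. 119] -/
theorem theaterIsoCanonical_of_mapKNF_id
    (hid : ∀ (E : FundamentalExtension.{u}) (x : R.kNF E), R.mapKNF (𝟙 E) (isEAHom_id E) x = x) :
    TheaterIsoCanonical R := by
  intro T
  obtain ⟨ψ, hsmul, hgen, hnon, harc, hb⟩ := T.exists_referenceIso
  refine ⟨{ φgrp := 𝟙 T.ext
            isEAHom := isEAHom_id T.ext
            φV := ψ
            φV_smul := hsmul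
            φV_generic := hgen
            image_non := hnon
            image_arc := harc
            arch_compat := fun v hv => ?_ }, rfl⟩
  obtain ⟨ψv, hhomeo, ⟨c, hc⟩, hκ⟩ := hb v hv
  exact ⟨ψv, hhomeo, ⟨c, fun a => hc a⟩, fun x => by rw [hid]; exact hκ x⟩

end Conditional

end Literature.AnabelianGeometry.AbsoluteAnabelian
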